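/-
Copyright (c) 2026 the pub-hodgecm-mathlib formalisation cell (harness21).  Prover seat hodgecm-mathlib-K2E4-p14 (g9), Track B ∕ K2-LIT, h413 = `stmt-HodgeConjecture-24833`,
line `K2_E1_TraceFormulaBeta`, campaign «EIS-R7-BL-SPH-3» — FILE 4 (dealer K2E1-plan (g7) (200)∕(216)): «(H4-b)₃-sph» LETTER-FREE.  The meromorphic continuation of the spherical
Borel Eisenstein series of `U(2,1)_{L∕L⁺}` to `{Re z > 1}` with exactly one pole, simple, at `z = 2ρ = 2`, from the structural measures alone.
-/
import Summits.HodgeConjecture.HodgeConjecture.Theorems.K2E1SphericalEisensteinL2BoundCMThree            -- ★∕📤 p860218 (this seat) FILE 3: `msP_of_road`, `ms2_of_road`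
import Summits.HodgeConjecture.HodgeConjecture.Theorems.K2E1SphericalEisensteinPoleControlCMThreeFinal     -- ★ p859972 (this seat, g8): `sphericalEisenstein_continuation_cm_three_of_road`; brings ★ (L3)₃
import Summits.HodgeConjecture.HodgeConjecture.Theorems.K2E1SphericalEisensteinMeromorphicExportsU3Bounds  -- ★ p859724 (this seat, g8): X2b₃ `sphericalEisenstein_meromorphic_exports_cm_three`
import Summits.HodgeConjecture.HodgeConjecture.Theorems.K2E1MaassSelbergFamilyCMThree                     -- ★ p859662 (K2E1-p11): CLOSER₃ `exists_truncatedFamily_cm_three`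
import HarnessLib

/-!
# K2·E1 — `K2E1SphericalEisensteinContinuationCMThree`: «(H4-b)₃-sph» LETTER-FREE — the spherical Eisenstein series `E(φ₀H^z)` of `U(2,1)_{L∕L⁺}` continues meromorphically to
# `{Re z > 1}` with a single simple pole at `z = 2` and residue `φ₀·r`, `r ≠ 0`

Track B ∕ K2-LIT, crux h413 = `stmt-HodgeConjecture-24833`, route of record `HCCMUnconditional`; cell `hodgecm-mathlib`, squad K2, ENGINE E1, campaign EIS-R7-BL-SPH-3.  THEOREMS ONLY
(no `def`, no `instance`, no notation, no named-fact hypothesis, no `sorry`); lane `--supports stmt-HodgeConjecture-24833 --as helper` (count-neutral).  Closes no socket.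

WHAT.  The capstone₃ ★ `sphericalEisenstein_continuation_cm_three_of_road` (K2E4-p14 (g8), p859972) with ALL its binders discharged: the EXPORTS₃ objects from ★ X2b₃
`sphericalEisenstein_meromorphic_exports_cm_three` (Bernstein–Lapid road: `Ec`, the pole set `P`, the per-ball holomorphy sets, test functions, vector solutions, (E1)(E2)(E4)(E5)),
the operator road's per-ball truncated `L²` families from ★ CLOSER₃ `exists_truncatedFamily_cm_three` (one level per ball, `choose`), the scalar letters from ★ (L3)₃
`sphericalConstantTerm_continuation_cm_three_one`, and the two Maass–Selberg letters (MS-2)∕(MS-P) from ★ FILE 3 `ms2_of_road` ∕ `msP_of_road` (K2E4-p14 (g9): the diagonal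
Maass–Selberg identity on both half-planes, the reflection principle for the scalar, and the real-axis cancellation of the `1∕|Im z|` terms).  What remains as hypotheses is STRUCTURE
ONLY: the automorphic measure `μ`, a Haar measure `ν_G` (inversion-invariant, s-finite), a Haar measure `ν` on `N(𝔸)` (right- and inversion-invariant) with a fundamental domain `𝓕` of
`N(L⁺)` of compact closure normalised to `ν 𝓕 = 1`, a covering weight `β` with its unfolded measure `μZ`, Haar measures on the maximal compact subgroup and on the ideles with an idele
class domain, a trace-zero `δ ≠ 0` of `L`, and the constant `φ₀`.
* HEAD **`sphericalEisenstein_continuation_cm_three`** :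
  `∃ r ≠ 0, ∀ g, ∃ Ẽ_g, MeromorphicOn Ẽ_g {1 < Re} ∧ DifferentiableOn ℂ Ẽ_g ({1 < Re} ∖ {2}) ∧ (∀ z, 2 < Re z → Ẽ_g z = E(φ₀H^z)(g)) ∧ Tendsto ((z − 2)·Ẽ_g) (𝓝[≠] 2) (𝓝 (φ₀·r))`.
HONEST LABEL: HC_CM is proved only modulo the 7 printed citations (2 remaining named inputs: hLiu418 = `stmt-HodgeConjecture-24832`, h413 = `stmt-HodgeConjecture-24833`) until rung 0
closes; this file asserts no named fact and closes no socket; count-neutral; UNCONDITIONAL in the structural data (no Maass–Selberg ∕ EXPORTS ∕ (L3) letter is left).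

## References
* [MoeglinWaldspurger1995] C. Mœglin, J.-L. Waldspurger, *Spectral decomposition and Eisenstein series* (1995), II.1.7, IV.1.8–IV.1.11, IV.2.3, IV.3.12.
* [Langlands1976] R. P. Langlands, *On the functional equations satisfied by Eisenstein series*, LNM 544 (1976), §7 and Appendix.
* [BernsteinLapid2019] J. Bernstein, E. Lapid, *On the meromorphic continuation of Eisenstein series*, J. AMS 37 (2024), Thm 2.3, §4.
* [Arthur1980TraceFormulaII] J. Arthur, *A trace formula for reductive groups II*, Compositio Math. 40 (1980), §4.
-/

set_option autoImplicit false
-- the mandated namespace repeats `HodgeConjecture.HodgeConjecture`, as in every `Theorems/*.lean` of this sub-problem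
set_option linter.dupNamespace false

noncomputable section

open MeasureTheory MeasureTheory.Measure Set NumberField IsDedekindDomain Filter Topology Metric
open scoped NNReal ENNReal
open Literature.MeasureTheory.Group Literature.NumberTheory
open Literature.NumberTheory.Automorphic Literature.NumberTheory.Automorphic.UnitaryGroup AdelicGroupData
open Summit.HodgeConjecture.HodgeConjecture.Cruxes.H413.K2E1BorelEisensteinU
open Summit.HodgeConjecture.HodgeConjecture.Cruxes.H413.K2E1BLBorelSpacesU2Defs
open Summit.HodgeConjecture.HodgeConjecture.Cruxes.H413.K2E1SphericalEisensteinL2BoundCMThree (msP_of_road ms2_of_road)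
open Summit.HodgeConjecture.HodgeConjecture.Cruxes.H413.K2E1SphericalEisensteinPoleControlCMThreeFinal (sphericalEisenstein_continuation_cm_three_of_road)
open Summit.HodgeConjecture.HodgeConjecture.Cruxes.H413.K2E1SphericalEisensteinMeromorphicExportsU3Bounds (sphericalEisenstein_meromorphic_exports_cm_three)
open Summit.HodgeConjecture.HodgeConjecture.Cruxes.H413.K2E1MaassSelbergFamilyCMThree (exists_truncatedFamily_cm_three)
open Summit.HodgeConjecture.HodgeConjecture.Cruxes.H413.K2E1SphericalConstantTermContinuationCMThree (sphericalConstantTerm_continuation_cm_three_one)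

namespace Summit.HodgeConjecture.HodgeConjecture.Cruxes.H413.K2E1SphericalEisensteinContinuationCMThree

variable (L : Type) [Field L] [NumberField L] [IsCMField L]
variable [MeasurableSpace (quasiSplit (↥(maximalRealSubfield L)) L (IsCMField.complexConj L) 3).Adelic] [BorelSpace (quasiSplit (↥(maximalRealSubfield L)) L (IsCMField.complexConj L) 3).Adelic]
variable [MeasurableSpace (AdeleRing (𝓞 L) L)ˣ] [BorelSpace (AdeleRing (𝓞 L) L)ˣ]

/-- **«(H4-b)₃-sph», LETTER-FREE.**  For the CM pair `L ∕ L⁺` and the quasi-split unitary group `U(2,1)` in three variables, with structural measures as in the module docstring, a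
trace-zero `δ ≠ 0` and any constant `φ₀`: there is `r ≠ 0` such that for every adelic point `g` the spherical Borel Eisenstein series `z ↦ E(φ₀H^z)(g)` (Godement-convergent on
`{Re z > 2}`) has a continuation `Ẽ_g`, MEROMORPHIC on `{Re z > 1}`, HOLOMORPHIC off `z = 2`, with `(z − 2)Ẽ_g(z) → φ₀·r` at `2`.  Proof: ★ `_of_road` fed with ★ X2b₃, ★ CLOSER₃ (one level
per ball, by `choose`), ★ (L3)₃ and ★ FILE 3's (MS-2)∕(MS-P). [cite: MoeglinWaldspurger1995, IV.1.8–IV.1.11, IV.3.12] [cite: Langlands1976, §7] [cite: BernsteinLapid2019, Thm 2.3, §4]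
[cite: Arthur1980TraceFormulaII, §4] -/
theorem sphericalEisenstein_continuation_cm_three
    (μ : Measure (quasiSplit (↥(maximalRealSubfield L)) L (IsCMField.complexConj L) 3).automorphicQuotient) [(quasiSplit (↥(maximalRealSubfield L)) L (IsCMField.complexConj L) 3).IsAutomorphicMeasure μ]
    (νG : Measure (quasiSplit (↥(maximalRealSubfield L)) L (IsCMField.complexConj L) 3).Adelic) [νG.IsHaarMeasure] [νG.IsInvInvariant] [SFinite νG]
    (ν : Measure ↥(adelicUnipotent (↥(maximalRealSubfield L)) L (IsCMField.complexConj L) 3)) [ν.IsHaarMeasure] [ν.IsMulRightInvariant] [ν.IsInvInvariant]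
    {𝓕 : Set ↥(adelicUnipotent (↥(maximalRealSubfield L)) L (IsCMField.complexConj L) 3)}
    (h𝓕N : IsFundamentalDomain ↥(rationalUnipotent (↥(maximalRealSubfield L)) L (IsCMField.complexConj L) 3) 𝓕 ν) (h𝓕c : IsCompact (closure 𝓕)) (h𝓕1 : ν 𝓕 = 1)
    {β : (quasiSplit (↥(maximalRealSubfield L)) L (IsCMField.complexConj L) 3).Adelic → ℝ≥0∞}
    (hβ : IsCoveringWeight ↥((arithmeticBorel (↥(maximalRealSubfield L)) L (IsCMField.complexConj L) 3).map (quasiSplit (↥(maximalRealSubfield L)) L (IsCMField.complexConj L) 3).arithmeticSubgroup.subtype) β)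
    {μZ : Measure (borelQuotient (↥(maximalRealSubfield L)) L (IsCMField.complexConj L) 3)} [SFinite μZ]
    (hμZ : ∀ f : borelQuotient (↥(maximalRealSubfield L)) L (IsCMField.complexConj L) 3 → ℝ≥0∞, Measurable f → ∫⁻ z, f z ∂μZ = ∫⁻ g, β g * f (toBorelQuotient (↥(maximalRealSubfield L)) L (IsCMField.complexConj L) 3 g) ∂νG)
    (μK : Measure ((standardMaximalCompactGL 3 L).comap (adelicVal (↥(maximalRealSubfield L)) L (IsCMField.complexConj L) 3 ((StdForm.antidiagonal 3).over L)) : Subgroup (quasiSplit (↥(maximalRealSubfield L)) L (IsCMField.complexConj L) 3).Adelic))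
    [μK.IsHaarMeasure]
    (νI : Measure (AdeleRing (𝓞 L) L)ˣ) [νI.IsHaarMeasure]
    {𝓕I : Set (AdeleRing (𝓞 L) L)ˣ} (h𝓕I : IsIdeleClassDomain L 𝓕I)
    {δ : L} (hcδ : IsCMField.complexConj L δ = -δ) (hδ : δ ≠ 0) (φ₀ : ℂ) :
    ∃ r : ℂ, r ≠ 0 ∧ ∀ g : (quasiSplit (↥(maximalRealSubfield L)) L (IsCMField.complexConj L) 3).Adelic, ∃ Eg : ℂ → ℂ,
      MeromorphicOn Eg {z : ℂ | 1 < z.re} ∧ DifferentiableOn ℂ Eg ({z : ℂ | 1 < z.re} \ {2}) ∧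
      (∀ z : ℂ, 2 < z.re → Eg z = eisensteinSeriesU (flatSectionU (fun _ : (quasiSplit (↥(maximalRealSubfield L)) L (IsCMField.complexConj L) 3).Adelic => φ₀) z) g) ∧
      Tendsto (fun z : ℂ => (z - 2) * Eg z) (𝓝[≠] 2) (𝓝 (φ₀ * r)) := by
  have h𝓕₀ : ν 𝓕 ≠ 0 := by rw [h𝓕1]; exact one_ne_zero
  -- ★ X2b₃: the Bernstein–Lapid exports
  obtain ⟨Ec, P, cI, I, hI, η, h, a, κ, T, U, vX, cc, hNF, hEcE, hPc, hPcd, hPre, -, hE1, hE4, hE2, -, -, -, -, hballs⟩ :=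
    sphericalEisenstein_meromorphic_exports_cm_three L μ νG ν h𝓕N h𝓕c h𝓕₀ hβ hμZ φ₀
  -- ★ CLOSER₃: one truncated `L²` family per ball (index `n` = the ball `n + 1`)
  have hcl : ∀ n : ℕ, ∃ T₀ : ℝ≥0, 1 ≤ T₀ ∧ ∃ Fam : ℂ → Lp ℂ 2 μ, DifferentiableOn ℂ Fam (U n \ P) ∧
      ∀ z ∈ U n \ P, ((Fam z : Lp ℂ 2 μ) : (quasiSplit (↥(maximalRealSubfield L)) L (IsCMField.complexConj L) 3).automorphicQuotient → ℂ) =ᵐ[μ]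
        (quasiSplit (↥(maximalRealSubfield L)) L (IsCMField.complexConj L) 3).quotFun (truncation ν 𝓕 T₀ (Ec z)) := fun n => by
    haveI := hI n
    obtain ⟨hR1, hdef, hreg, hcov, ha, hκ, hΩ, hTX, hUo, hUD, -, -, hvXd, -, -, -, -, -, hE5⟩ := hballs n
    exact exists_truncatedFamily_cm_three L μ νG ν h𝓕N h𝓕c h𝓕₀ hβ hμZ (n + 1) (η n) (h n) (a n) (κ n) (T n) (U n) (vX n)
      (fun i => (hR1 i).1) hdef (fun i => ⟨(hreg i).1, (hreg i).2.1⟩) hcov ha hκ hΩ hTX hUo hUD hvXd Ec P hE5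
  choose T₀ hT₀ Fam hFd hFam using hcl
  -- ★ (L3)₃: the scalar, with the `ν 𝓕 = 1` normalisation of its tube formula
  obtain ⟨c, r, -, -, hchol, hcres, hceq⟩ := sphericalConstantTerm_continuation_cm_three_one L hcδ hδ ν h𝓕N h𝓕c
  have hceq' : ∀ z : ℂ, 2 < z.re → c z = (∫ v : ↥(adelicUnipotent (↥(maximalRealSubfield L)) L (IsCMField.complexConj L) 3), (((borelHeight ((quasiSplit (↥(maximalRealSubfield L)) L (IsCMField.complexConj L) 3).toAdelic (weylLongU ((IsCMField.complexConj L : L ≃ₐ[↥(maximalRealSubfield L)] L) : L →+* L) (rfl : (StdForm.antidiagonal 3).over L = (StdForm.antidiagonal 3).over L)) * (v : (quasiSplit (↥(maximalRealSubfield L)) L (IsCMField.complexConj L) 3).Adelic))) : ℝ) : ℂ) ^ z ∂ν) := by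
    intro z hz
    rw [hceq z hz, h𝓕1, ENNReal.toReal_one, inv_one, Complex.ofReal_one, one_mul]
  have hR : ∀ n : ℕ, (3 : ℝ) ≤ ((n + 1 : ℕ) : ℝ) + 2 := fun n => by
    have : (0 : ℝ) ≤ n := n.cast_nonneg
    push_cast
    linarith
  -- ★ FILE 3: the two Maass–Selberg letters, PAID
  have hMS2 : ∃ C : ℝ, ∀ᶠ z in 𝓝[≠] (2 : ℂ), ‖(z - 2) • Fam 2 z‖ ≤ C := by
    obtain ⟨-, -, -, -, -, -, -, -, hUo, -, -, hUcod, -, -, -, -, -, -, -⟩ := hballs 2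
    exact ms2_of_road L μ νG μK νI h𝓕I ν h𝓕N h𝓕1 h𝓕c hβ hchol hceq' (hR 2) hUo hUcod hPc hPcd Ec hEcE (hT₀ 2) (Fam 2) (hFd 2) (hFam 2) hcres
  have hMSP : ∀ n, ∀ z₀ ∈ P, 1 < z₀.re → z₀ ≠ 2 → z₀ ∈ Metric.ball (0 : ℂ) (((n + 1 : ℕ) : ℝ) + 2) → ∃ C : ℝ, ∀ᶠ z in 𝓝[≠] z₀, ‖Fam n z‖ ≤ C :=
    fun n z₀ _ hz₀ hz₀2 hz₀b => by
    obtain ⟨-, -, -, -, -, -, -, -, hUo, -, -, hUcod, -, -, -, -, -, -, -⟩ := hballs n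
    exact msP_of_road L μ νG μK νI h𝓕I ν h𝓕N h𝓕1 h𝓕c hβ hchol hceq' (hR n) hUo hUcod hPc hPcd Ec hEcE (hT₀ n) (Fam n) (hFd n) (hFam n) hz₀b hz₀ hz₀2
  -- ★ the road
  exact sphericalEisenstein_continuation_cm_three_of_road L μ νG ν h𝓕N h𝓕c hcδ hδ φ₀ Ec P hNF hEcE hPc hPcd hPre hE1 hE4 hE2 I h U vX
    (fun n => by obtain ⟨-, -, -, -, -, -, -, -, hUo, -⟩ := hballs n; exact hUo)
    (fun n => by obtain ⟨-, -, -, -, -, -, -, -, -, hUD, -⟩ := hballs n; exact hUD)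
    (fun n => by obtain ⟨-, -, -, -, -, -, -, -, -, -, -, hUcod, -⟩ := hballs n; exact hUcod)
    (fun n => by obtain ⟨-, -, -, hcov, -⟩ := hballs n; exact hcov)
    (fun n => by obtain ⟨-, -, -, -, -, -, -, -, -, -, -, -, -, -, -, -, -, -, hE5⟩ := hballs n; exact hE5)
    T₀ hT₀ Fam hFd hFam hMS2 hMSP

end Summit.HodgeConjecture.HodgeConjecture.Cruxes.H413.K2E1SphericalEisensteinContinuationCMThree

end
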